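import Mathlib
import Literature.AlgebraicGeometry.Resolution.OneDimensionalBlowupTowerStep
import HarnessLib

/-!
# Krull's blow-up tower of a one-dimensional local ring with reduced completion (Kollár Thm. 1.101)

Topic: `Literature/AlgebraicGeometry/Resolution`. DISCHARGE of the named fact
`Kollar2007_thm_1_101_localChain` (`OneDimensionalBlowupTower.lean`; Kollár 2007, Thm. 1.101
(3) ⇒ (1) with Def. 1.97, Lemma 1.99, Alg. 1.100; Krull 1930, Satz 7): for a one-dimensional
Noetherian local ring `A` with reduced `𝔪`-adic completion there is a bound `m(A)` such that every
chain of local quadratic transforms `A ≅ R₀, R₁, …` (local rings of blowings up of points with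
`J_x = 𝔪_x`) contains a regular local ring `R_i`, `i ≤ m`.

Proof (branch by branch, NOT Kollár's semi-local length count): the class `P` = "reduced
Noetherian local, every minimal prime `q` has `dim R/q = 1` and `R/q` of finite normalization"
contains `A` (Huneke–Swanson 9.1.3 + Krull's criterion, `AnalyticallyUnramifiedQuotient.lean`) and
is stable under local quadratic transforms (`ReducedQuadraticTransform*.lean`,
`QuadraticTransformDelta.lean`); the potential
`Ψ(R) = Σ_q δ(R/q) + Σ_{q≠q'} contactOrder(θ_q(R), θ_q(q'))` (`BlowupTowerPotential.lean`) drops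
strictly at every local quadratic transform of a non-regular `R` (`towerPotential_add_one_le`:
if two branches pass through the new point a contact order drops, `BranchContactOrder.lean`; if
two branches separate a positive contact term disappears; if `R` is a domain, `δ` drops,
`IsQuadraticTransform.curveDelta_lt`); the assembly along chains of blowings up is
`kollar2007_thm_1_101_localChain_of_invariant` (`LocalBlowupChainBound.lean`).

* `towerPotential_add_one_le` — the one-step drop;
* `Kollar2007_thm_1_101_localChain_holds` — **the named fact is a theorem**.

## Sources

* J. Kollár, *Lectures on Resolution of Singularities*, Ann. of Math. Stud. 166 (2007), §1.4,
  Def. 1.97, Lemma 1.99, Alg. 1.100, Thm. 1.101 (pp. 57–59). [Kollar2007]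
* C. Huneke, I. Swanson, *Integral Closure of Ideals, Rings, and Modules* (2006), Prop. 9.1.3.
  [HunekeSwanson2006]
-/

noncomputable section

open IsLocalRing

namespace Literature.AlgebraicGeometry.Resolution

universe u

/-! ## The one-step drop of the tower potential -/

section Step

variable {R : Type u} [CommRing R] [IsLocalRing R] [IsNoetherianRing R] [IsReduced R]
  (hdim : ∀ q ∈ minimalPrimes R, ringKrullDim (R ⧸ q) = 1)
  (hfin : ∀ (q : Ideal R) [q.IsPrime], q ∈ minimalPrimes R →
    Module.Finite (R ⧸ q) (integralClosure (R ⧸ q) (FractionRing (R ⧸ q))))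
  {k : ℕ} (c : Fin k → R) (hc : Ideal.span (Set.range c) = maximalIdeal R) (i : Fin k)
  (𝔴 : Ideal (chartRing c i)) [𝔴.IsPrime] (h𝔴 : 𝔴.comap (chartBase c i) = maximalIdeal R)
  (S : Type u) [CommRing S] [IsLocalRing S] [Algebra (chartRing c i) S] [IsLocalization.AtPrime S 𝔴]

include hdim hfin hc h𝔴 in
/-- **The one-step drop of the tower potential**: for a non-regular `R` in the class (reduced
Noetherian local, branches of dimension one with finite normalization) and a local quadratic
transform `S = B_𝔴` (`𝔴` over `𝔪_R` in a chart of `Bl_𝔪 Spec R`),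
`towerPotential S + 1 ≤ towerPotential R`. [cite: Kollar2007, Alg. 1.100, Thm. 1.101] -/
theorem towerPotential_add_one_le (hreg : ¬ IsRegularLocalRing R) :
    towerPotential S + 1 ≤ towerPotential R := by
  classical
  have hR : (minimalPrimes R).Finite := minimalPrimes.finite_of_isNoetherianRing R
  haveI : IsNoetherianRing S := isNoetherianRing_of_isLocalization c i 𝔴 S
  have hS : (minimalPrimes S).Finite := minimalPrimes.finite_of_isNoetherianRing S
  rw [towerPotential_eq hS, towerPotential_eq hR]
  set F := hR.toFinset with hFdef
  set F₁ := hS.toFinset with hF₁def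
  have hF : ∀ q, q ∈ F ↔ q ∈ minimalPrimes R := fun q => Set.Finite.mem_toFinset _
  have hF₁ : ∀ 𝔔, 𝔔 ∈ F₁ ↔ 𝔔 ∈ minimalPrimes S := fun 𝔔 => Set.Finite.mem_toFinset _
  -- the branch `σ 𝔔` of `R` under each minimal prime `𝔔` of `S`
  have key : ∀ 𝔔 : Ideal S, 𝔔 ∈ minimalPrimes S → ∃ (q : Ideal R) (_ : q.IsPrime)
      (_ : q ∈ minimalPrimes R) (hq : c i ∉ q) (hpass : RingHom.ker (chartBranchMap c i q hq) ≤ 𝔴),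
      𝔔 = RingHom.ker (branchMap c i q hq 𝔴 S hpass) :=
    fun 𝔔 h𝔔 => (mem_minimalPrimes_iff c i 𝔴 S 𝔔).mp h𝔔
  choose σ₀ hσp hσm hσq hσpass hσeq using key
  let σ : Ideal S → Ideal R := fun 𝔔 => if h : 𝔔 ∈ minimalPrimes S then σ₀ 𝔔 h else ⊥
  have hσ : ∀ 𝔔 (h : 𝔔 ∈ minimalPrimes S), σ 𝔔 = σ₀ 𝔔 h := fun 𝔔 h => dif_pos h
  have hσF : ∀ 𝔔 ∈ F₁, σ 𝔔 ∈ F := fun 𝔔 h => by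
    rw [hF, hσ 𝔔 ((hF₁ 𝔔).mp h)]; exact hσm 𝔔 _
  have hσinj : Set.InjOn σ ↑F₁ := by
    intro 𝔔 h𝔔 𝔔' h𝔔' hh
    have h1 := (hF₁ 𝔔).mp h𝔔
    have h2 := (hF₁ 𝔔').mp h𝔔'
    rw [hσ 𝔔 h1, hσ 𝔔' h2] at hh
    haveI := hσp 𝔔 h1; haveI := hσp 𝔔' h2
    rw [hσeq 𝔔 h1, hσeq 𝔔' h2]
    exact ker_branchMap_congr c i 𝔴 S hh _ _ _ _
  -- (A) per-branch comparison: `T_S(𝔔) + #(other branches of S) ≤ T_R(σ 𝔔)`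
  have hA : ∀ 𝔔 ∈ F₁,
      branchDelta S 𝔔 + ∑ 𝔔' ∈ F₁.erase 𝔔, branchContact S 𝔔 𝔔' +
          ((F₁.erase 𝔔).card : ℕ∞) ≤
        branchDelta R (σ 𝔔) + ∑ q' ∈ F.erase (σ 𝔔), branchContact R (σ 𝔔) q' := by
    intro 𝔔 h𝔔
    have h1 := (hF₁ 𝔔).mp h𝔔
    haveI := hσp 𝔔 h1
    obtain ⟨-, -, hδ, -, hpair⟩ := branch_step hdim hfin c hc i 𝔴 h𝔴 S (σ₀ 𝔔 h1) (hσm 𝔔 h1)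
      (hσq 𝔔 h1) (hσpass 𝔔 h1)
    rw [← hσeq 𝔔 h1] at hδ hpair
    rw [hσ 𝔔 h1]
    have hpairs : ∑ 𝔔' ∈ F₁.erase 𝔔, branchContact S 𝔔 𝔔' + ((F₁.erase 𝔔).card : ℕ∞) ≤
        ∑ q' ∈ F.erase (σ₀ 𝔔 h1), branchContact R (σ₀ 𝔔 h1) q' := by
      calc ∑ 𝔔' ∈ F₁.erase 𝔔, branchContact S 𝔔 𝔔' + ((F₁.erase 𝔔).card : ℕ∞)
          = ∑ 𝔔' ∈ F₁.erase 𝔔, (branchContact S 𝔔 𝔔' + 1) := by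
            rw [Finset.sum_add_distrib, Finset.sum_const, nsmul_one]
        _ ≤ ∑ 𝔔' ∈ F₁.erase 𝔔, branchContact R (σ₀ 𝔔 h1) (σ 𝔔') := by
            refine Finset.sum_le_sum fun 𝔔' h𝔔' => ?_
            have h2 := (hF₁ 𝔔').mp (Finset.mem_of_mem_erase h𝔔')
            haveI := hσp 𝔔' h2
            have hne : σ₀ 𝔔' h2 ≠ σ₀ 𝔔 h1 := by
              intro heq
              apply Finset.ne_of_mem_erase h𝔔'
              rw [hσeq 𝔔' h2, hσeq 𝔔 h1]
              exact ker_branchMap_congr c i 𝔴 S heq _ _ _ _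
            have h3 := hpair (σ₀ 𝔔' h2) (hσq 𝔔' h2) (hσpass 𝔔' h2) (hσm 𝔔' h2) hne
            rw [← hσeq 𝔔' h2] at h3
            rw [hσ 𝔔' h2]; exact h3
        _ = ∑ q' ∈ (F₁.erase 𝔔).image σ, branchContact R (σ₀ 𝔔 h1) q' := by
            rw [Finset.sum_image fun x hx y hy hxy =>
              hσinj (Finset.mem_coe.mpr (Finset.mem_of_mem_erase hx))
                (Finset.mem_coe.mpr (Finset.mem_of_mem_erase hy)) hxy]
        _ ≤ ∑ q' ∈ F.erase (σ₀ 𝔔 h1), branchContact R (σ₀ 𝔔 h1) q' := by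
            apply Finset.sum_le_sum_of_subset
            intro q' hq'
            obtain ⟨𝔔', h𝔔', rfl⟩ := Finset.mem_image.mp hq'
            refine Finset.mem_erase.mpr ⟨?_, hσF 𝔔' (Finset.mem_of_mem_erase h𝔔')⟩
            rw [← hσ 𝔔 h1]
            exact fun heq => Finset.ne_of_mem_erase h𝔔'
              (hσinj (Finset.mem_coe.mpr (Finset.mem_of_mem_erase h𝔔')) (Finset.mem_coe.mpr h𝔔) heq)
    calc branchDelta S 𝔔 + ∑ 𝔔' ∈ F₁.erase 𝔔, branchContact S 𝔔 𝔔' + ((F₁.erase 𝔔).card : ℕ∞)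
        = branchDelta S 𝔔 +
            (∑ 𝔔' ∈ F₁.erase 𝔔, branchContact S 𝔔 𝔔' + ((F₁.erase 𝔔).card : ℕ∞)) := by
          rw [add_assoc]
      _ ≤ branchDelta R (σ₀ 𝔔 h1) + ∑ q' ∈ F.erase (σ₀ 𝔔 h1), branchContact R (σ₀ 𝔔 h1) q' :=
          add_le_add hδ hpairs
  -- (B) reindex along the injection `σ`
  have hB : ∑ 𝔔 ∈ F₁, (branchDelta R (σ 𝔔) + ∑ q' ∈ F.erase (σ 𝔔), branchContact R (σ 𝔔) q') ≤
      ∑ q ∈ F, (branchDelta R q + ∑ q' ∈ F.erase q, branchContact R q q') := by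
    rw [← Finset.sum_image (f := fun q => branchDelta R q + ∑ q' ∈ F.erase q, branchContact R q q')
      fun x hx y hy hxy => hσinj (Finset.mem_coe.mpr hx) (Finset.mem_coe.mpr hy) hxy]
    exact Finset.sum_le_sum_of_subset fun q hq => by
      obtain ⟨𝔔, h𝔔, rfl⟩ := Finset.mem_image.mp hq
      exact hσF 𝔔 h𝔔
  have hC : ∑ 𝔔 ∈ F₁, (branchDelta S 𝔔 + ∑ 𝔔' ∈ F₁.erase 𝔔, branchContact S 𝔔 𝔔') +
      ∑ 𝔔 ∈ F₁, ((F₁.erase 𝔔).card : ℕ∞) ≤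
      ∑ q ∈ F, (branchDelta R q + ∑ q' ∈ F.erase q, branchContact R q q') := by
    rw [← Finset.sum_add_distrib]
    exact (Finset.sum_le_sum hA).trans hB
  -- a minimal prime `𝔔₀` of `S`
  obtain ⟨𝔔₀, h𝔔₀, -⟩ :=
    Ideal.exists_minimalPrimes_le (I := (⊥ : Ideal S)) (J := maximalIdeal S) bot_le
  have h𝔔₀F : 𝔔₀ ∈ F₁ := (hF₁ _).mpr h𝔔₀
  by_cases htwo : ∃ 𝔔₁ ∈ F₁, 𝔔₁ ≠ 𝔔₀
  · -- two branches pass through the new point: a contact order drops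
    obtain ⟨𝔔₁, h𝔔₁, hne⟩ := htwo
    have hcard : (1 : ℕ∞) ≤ ∑ 𝔔 ∈ F₁, ((F₁.erase 𝔔).card : ℕ∞) := by
      refine le_trans ?_ (Finset.single_le_sum (f := fun 𝔔 => ((F₁.erase 𝔔).card : ℕ∞))
        (fun _ _ => zero_le) h𝔔₀F)
      have : 𝔔₁ ∈ F₁.erase 𝔔₀ := Finset.mem_erase.mpr ⟨hne, h𝔔₁⟩
      exact_mod_cast Finset.card_pos.mpr ⟨𝔔₁, this⟩
    calc ∑ 𝔔 ∈ F₁, (branchDelta S 𝔔 + ∑ 𝔔' ∈ F₁.erase 𝔔, branchContact S 𝔔 𝔔') + 1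
        ≤ ∑ 𝔔 ∈ F₁, (branchDelta S 𝔔 + ∑ 𝔔' ∈ F₁.erase 𝔔, branchContact S 𝔔 𝔔') +
            ∑ 𝔔 ∈ F₁, ((F₁.erase 𝔔).card : ℕ∞) := add_le_add_right hcard _
      _ ≤ _ := hC
  · -- a single branch of `S`
    have hF₁eq : F₁ = {𝔔₀} := by
      ext 𝔔
      simp only [Finset.mem_singleton]
      constructor
      · intro h; by_contra hne; exact htwo ⟨𝔔, h, hne⟩
      · rintro rfl; exact h𝔔₀F
    have h1 := (hF₁ 𝔔₀).mp h𝔔₀F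
    haveI := hσp 𝔔₀ h1
    obtain ⟨-, -, hδ, hδeq, -⟩ := branch_step hdim hfin c hc i 𝔴 h𝔴 S (σ₀ 𝔔₀ h1) (hσm 𝔔₀ h1)
      (hσq 𝔔₀ h1) (hσpass 𝔔₀ h1)
    rw [← hσeq 𝔔₀ h1] at hδ hδeq
    have hq₀F : σ₀ 𝔔₀ h1 ∈ F := (hF _).mpr (hσm 𝔔₀ h1)
    rw [hF₁eq, Finset.sum_singleton, Finset.erase_singleton, Finset.sum_empty, add_zero]
    -- `T_R(q₀) ≤ Σ_F T_R`
    refine le_trans ?_ (Finset.single_le_sum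
      (f := fun q => branchDelta R q + ∑ q' ∈ F.erase q, branchContact R q q')
      (fun _ _ => zero_le) hq₀F)
    by_cases hother : ∃ q₁ ∈ F, q₁ ≠ σ₀ 𝔔₀ h1
    · -- another branch of `R` separates: its (positive) contact term disappears
      obtain ⟨q₁, hq₁, hne⟩ := hother
      haveI : q₁.IsPrime := ((hF q₁).mp hq₁).1.1
      have hone : (1 : ℕ∞) ≤ ∑ q' ∈ F.erase (σ₀ 𝔔₀ h1), branchContact R (σ₀ 𝔔₀ h1) q' :=
        le_trans (one_le_branchContact hdim hfin (σ₀ 𝔔₀ h1) q₁ (hσm 𝔔₀ h1))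
          (Finset.single_le_sum (f := fun q' => branchContact R (σ₀ 𝔔₀ h1) q')
            (fun _ _ => zero_le) (Finset.mem_erase.mpr ⟨hne, hq₁⟩))
      exact add_le_add hδ hone
    · -- `R` has the single minimal prime `q₀ = 0`: `R ≅ R/q₀` is a domain and `δ` drops
      have hFeq : F = {σ₀ 𝔔₀ h1} := by
        ext q
        simp only [Finset.mem_singleton]
        constructor
        · intro h; by_contra hne; exact hother ⟨q, h, hne⟩
        · rintro rfl; exact hq₀F
      have hq₀bot : σ₀ 𝔔₀ h1 = ⊥ := by
        have hmin : minimalPrimes R = {σ₀ 𝔔₀ h1} := by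
          ext q; rw [← hF, hFeq, Finset.mem_singleton, Set.mem_singleton_iff]
        have h2 := Ideal.sInf_minimalPrimes (I := (⊥ : Ideal R))
        change sInf (minimalPrimes R) = _ at h2
        rw [hmin, sInf_singleton] at h2
        rw [h2]
        refine le_bot_iff.mp fun x hx => ?_
        obtain ⟨n, hn⟩ := hx
        exact (Ideal.mem_bot).mpr (IsReduced.eq_zero x ⟨n, hn⟩)
      have hne : branchDelta S 𝔔₀ ≠ branchDelta R (σ₀ 𝔔₀ h1) := by
        intro heq
        apply hreg
        have hreg' := hδeq heq
        have e : R ⧸ σ₀ 𝔔₀ h1 ≃+* R :=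
          (Ideal.quotEquivOfEq hq₀bot).trans (RingEquiv.quotientBot R)
        exact IsRegularLocalRing.of_ringEquiv e
      have hlt : branchDelta S 𝔔₀ < branchDelta R (σ₀ 𝔔₀ h1) := lt_of_le_of_ne hδ hne
      rw [hFeq, Finset.erase_singleton, Finset.sum_empty, add_zero]
      exact Order.add_one_le_of_lt hlt

end Step

/-! ## The discharge -/

section Main

variable {R : Type u} [CommRing R] [IsLocalRing R] [IsNoetherianRing R] [IsReduced R]
  (hdim : ∀ q ∈ minimalPrimes R, ringKrullDim (R ⧸ q) = 1)
  (hfin : ∀ (q : Ideal R) [q.IsPrime], q ∈ minimalPrimes R →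
    Module.Finite (R ⧸ q) (integralClosure (R ⧸ q) (FractionRing (R ⧸ q))))
  {k : ℕ} (c : Fin k → R) (hc : Ideal.span (Set.range c) = maximalIdeal R) (j : Fin k)
  (𝔴 : PrimeSpectrum (chartRing c j)) (h𝔴 : 𝔴.asIdeal.comap (chartBase c j) = maximalIdeal R)
  (S : Type u) [CommRing S] [Algebra (chartRing c j) S] [IsLocalization.AtPrime S 𝔴.asIdeal]

include hdim hfin hc h𝔴 in
/-- The local quadratic transform `(B_j)_𝔴` is again in the class: reduced, Noetherian, local, with
one-dimensional branches of finite normalization. [cite: Kollar2007, §1.4] -/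
theorem towerClass_localization :
    ∃ (_ : IsLocalRing S) (_ : IsNoetherianRing S) (_ : IsReduced S),
      (∀ 𝔔 ∈ minimalPrimes S, ringKrullDim (S ⧸ 𝔔) = 1) ∧
      (∀ (𝔔 : Ideal S) [𝔔.IsPrime], 𝔔 ∈ minimalPrimes S →
          Module.Finite (S ⧸ 𝔔) (integralClosure (S ⧸ 𝔔) (FractionRing (S ⧸ 𝔔)))) := by
  haveI hLS : IsLocalRing S := IsLocalization.AtPrime.isLocalRing S 𝔴.asIdeal
  haveI hNS := isNoetherianRing_of_isLocalization c j 𝔴.asIdeal S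
  haveI hredS := isReduced_of_isLocalization c j 𝔴.asIdeal S
  have hbr : ∀ 𝔔 ∈ minimalPrimes S, ringKrullDim (S ⧸ 𝔔) = 1 ∧
      ∀ (_ : 𝔔.IsPrime), Module.Finite (S ⧸ 𝔔) (integralClosure (S ⧸ 𝔔) (FractionRing (S ⧸ 𝔔))) := by
    intro 𝔔 h𝔔
    obtain ⟨q, hp, hqm, hq, hpass, h𝔔eq⟩ := (mem_minimalPrimes_iff c j 𝔴.asIdeal S 𝔔).mp h𝔔
    obtain ⟨h1, h2, -⟩ := branch_step hdim hfin c hc j 𝔴.asIdeal h𝔴 S q hqm hq hpass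
    subst h𝔔eq
    exact ⟨h1, fun _ => h2⟩
  exact ⟨hLS, hNS, hredS, fun 𝔔 h𝔔 => (hbr 𝔔 h𝔔).1, fun 𝔔 hp h𝔔 => (hbr 𝔔 h𝔔).2 hp⟩

include hdim hfin hc h𝔴 in
/-- The potential of the local quadratic transform is smaller (as natural numbers).
[cite: Kollar2007, Alg. 1.100, Thm. 1.101] -/
theorem toNat_towerPotential_lt (hreg : ¬ IsRegularLocalRing R) :
    (towerPotential S).toNat < (towerPotential R).toNat := by
  haveI hLS : IsLocalRing S := IsLocalization.AtPrime.isLocalRing S 𝔴.asIdeal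
  have hle := towerPotential_add_one_le hdim hfin c hc j 𝔴.asIdeal h𝔴 S hreg
  have hRtop : towerPotential R ≠ ⊤ := towerPotential_ne_top hdim hfin
  have hStop : towerPotential S ≠ ⊤ := by
    intro htop; rw [htop, top_add] at hle; exact hRtop (top_le_iff.mp hle)
  have hlt : towerPotential S < towerPotential R := (ENat.add_one_le_iff hStop).mp hle
  rw [← ENat.coe_toNat hStop, ← ENat.coe_toNat hRtop] at hlt
  exact_mod_cast hlt

end Main

section Discharge

set_option maxHeartbeats 400000 in
/-- **Kollár 2007, Thm. 1.101 ((3) ⇒ (1)), pointwise along local blow-up chains — the named fact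
`Kollar2007_thm_1_101_localChain` is a theorem.** For a one-dimensional Noetherian local ring `A`
with reduced `𝔪`-adic completion there is `m = m(A)` such that every chain `A ≅ R₀, R₁, …` of local
quadratic transforms (local rings at points over `x` of blowings up along centres `D` with
`D_x = 𝔪_x`) reaches a regular local ring by stage `m`. Proof: the class «reduced Noetherian
local, every branch `R/q` one-dimensional with finite normalization» contains `A`
(Huneke–Swanson 9.1.3, Krull) and the tower potential `Ψ` drops strictly at every local quadratic
transform of a non-regular member (`towerPotential_add_one_le`); assemble with
`kollar2007_thm_1_101_localChain_of_invariant`. [cite: Kollar2007, Thm. 1.101, Def. 1.97, Alg. 1.100 (pp. 57–59)] -/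
theorem Kollar2007_thm_1_101_localChain_holds : Kollar2007_thm_1_101_localChain.{u} := by
  classical
  refine kollar2007_thm_1_101_localChain_of_invariant
    (fun R _ => ∃ (_ : IsLocalRing R) (_ : IsNoetherianRing R) (_ : IsReduced R),
      (∀ q ∈ minimalPrimes R, ringKrullDim (R ⧸ q) = 1) ∧
      (∀ (q : Ideal R) [q.IsPrime], q ∈ minimalPrimes R →
        Module.Finite (R ⧸ q) (integralClosure (R ⧸ q) (FractionRing (R ⧸ q)))))
    (fun R _ => (towerPotential R).toNat) ?_ ?_ ?_ ?_
  · -- invariance of the class under ring isomorphisms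
    intro R S _ _ e ⟨hloc, hN, hred, hdim, hfin⟩
    haveI := hloc; haveI := hN; haveI := hred
    refine ⟨e.isLocalRing, isNoetherianRing_of_ringEquiv R e,
      isReduced_of_injective e.symm e.symm.injective, fun q hq => ?_, fun q _ hq => ?_⟩
    · haveI : q.IsPrime := hq.1.1
      have hq' : q.comap (e : R →+* S) ∈ minimalPrimes R := by
        rw [minimalPrimes_eq_image_comap e]; exact ⟨q, hq, rfl⟩
      rw [← ringKrullDim_eq_of_ringEquiv (branchEquiv e q)]
      exact hdim _ hq'
    · have hq' : q.comap (e : R →+* S) ∈ minimalPrimes R := by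
        rw [minimalPrimes_eq_image_comap e]; exact ⟨q, hq, rfl⟩
      haveI : (q.comap (e : R →+* S)).IsPrime := Ideal.comap_isPrime _ _
      haveI := hfin _ hq'
      exact module_finite_integralClosure_of_ringEquiv (branchEquiv e q)
        (FractionRing (R ⧸ q.comap (e : R →+* S))) (FractionRing (S ⧸ q))
  · -- invariance of the potential
    intro R S _ _ e _
    exact congrArg ENat.toNat (towerPotential_eq_of_ringEquiv e)
  · -- the one-step drop along local quadratic transforms
    intro R _ _ ⟨hloc, hN, hred, hdim, hfin⟩ hreg
    haveI := hN; haveI := hred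
    obtain ⟨k, c, hc⟩ := Submodule.fg_iff_exists_fin_generating_family.mp
      (IsNoetherian.noetherian (maximalIdeal R))
    refine ⟨k, c, hc, fun j 𝔴 h𝔴 =>
      ⟨towerClass_localization hdim hfin c hc j 𝔴 h𝔴 (Localization.AtPrime 𝔴.asIdeal),
        toNat_towerPotential_lt hdim hfin c hc j 𝔴 h𝔴 (Localization.AtPrime 𝔴.asIdeal) hreg⟩⟩
  · -- the class contains every one-dimensional Noetherian local ring with reduced completion
    intro A _ _ _ hdim hred
    haveI := hred
    haveI : IsReduced A := isReduced_of_isReduced_adicCompletion (A := A) hred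
    exact ⟨inferInstance, inferInstance, inferInstance,
      fun q hq => ringKrullDim_quotient_eq_one_of_mem_minimalPrimes A hdim hq,
      fun q _ hq => module_finite_integralClosure_quotient_of_mem_minimalPrimes A hdim hq⟩

end Discharge

end Literature.AlgebraicGeometry.Resolution
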